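import Literature.MathematicalPhysics.KineticTheory.LambertianHardSphereFlow
import HarnessLib

/-!
# Joint space–time measurability of the Lambertian hard-sphere flow
# (crux `LambertianEuler`, stmt-AtomisticToContinuum-11854, line `Sketch`; tool of the kernel's ESTIMATE)

Helper file (`--supports`) of the crux
`Summit.AtomisticToContinuum.HydrodynamicLimit.Theses.LindebergRandomFuture.LambertianEuler`, line `Sketch`.
The Literature file `LambertianHardSphereFlow` proves that every time-`t` map `(z, ξs) ↦ Λ_t(z; ξs)` of the
Lambertian flow is jointly measurable in `(z, ξs)` (`measurable_lambertFlow`).  The kernel's ESTIMATE needs the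
windowed streaming integral `E_λ[∫_s^{s+h} Σ_i Dg_r((Λ_r)_i) dr]` as a time integral of ONE-TIME expectations
(Fubini), hence measurability of `((z, ξs), t) ↦ Λ_t(z; ξs)` JOINTLY IN TIME as well.  This file proves it for
any regular measurable geometry: the collision count `((z, ξs), t) ↦ K_t(z; ξs)` is jointly measurable
(`measurable_lambertCount_uncurry`: the fibres `{K = k}` are described by the measurable instants and the
measurable map `t ↦ ofReal t`), and `Λ_t = S_{t − t_K} z_K` is a measurable function of `(K, (z, ξs), t)`
composed with the measurable `((z, ξs), t) ↦ (K_t, (z, ξs), t)` (`measurable_lambertFlow_uncurry`; countable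
first factor).  On `𝕋³`: `measurable_lambertFlow_uncurry_torus`.

References: measure theory only. All `[folklore]`.
-/

noncomputable section

namespace Summit.AtomisticToContinuum.HydrodynamicLimit.Theorems.LambertianContactSwapLambertianEulerJointMeasurable

open scoped BigOperators Topology ENNReal
open MeasureTheory ProbabilityTheory Filter Set
open Literature.MathematicalPhysics.KineticTheory
open Literature.Analysis.FluidPDE Literature.Analysis.FluidPDE.Alexander

section General

variable {d : Type*} [Fintype d] {X : Type*} [MeasurableSpace X] [TopologicalSpace X]
  {N : ℕ} {G : Geometry d X} {ε : ℝ}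

/-- **The collision count of the Lambertian recursion is jointly measurable in `((z, ξs), t)`**
(regular measurable geometry): the fibre `{K = k}` is `{t_k ≤ t < t_{k+1}}` together with the junk fibre
of the accumulation event, all described by the measurable instants and `t ↦ ofReal t`. [folklore] -/
theorem measurable_lambertCount_uncurry (hG : G.IsHardSphereRegular ε) (hGm : G.IsMeasurable) :
    Measurable fun q : (Config N d X × (ℕ → EuclideanSpace ℝ d)) × ℝ => lambertCount G ε q.1.2 q.1.1 q.2 := by
  refine measurable_to_countable' fun k => ?_
  have hA : ∀ m, MeasurableSet {q : (Config N d X × (ℕ → EuclideanSpace ℝ d)) × ℝ |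
      lambertInstant G ε q.1.2 q.1.1 m ≤ ENNReal.ofReal q.2} := fun m =>
    measurableSet_le ((measurable_lambertInstant hG hGm m).comp measurable_fst)
      (ENNReal.measurable_ofReal.comp measurable_snd)
  have hset : (fun q : (Config N d X × (ℕ → EuclideanSpace ℝ d)) × ℝ => lambertCount G ε q.1.2 q.1.1 q.2) ⁻¹' {k} =
      {q | (lambertInstant G ε q.1.2 q.1.1 k ≤ ENNReal.ofReal q.2 ∧
        ¬lambertInstant G ε q.1.2 q.1.1 (k + 1) ≤ ENNReal.ofReal q.2) ∨
        (k = 0 ∧ ∀ m, lambertInstant G ε q.1.2 q.1.1 m ≤ ENNReal.ofReal q.2)} := by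
    ext q
    simp only [mem_preimage, mem_singleton_iff, mem_setOf_eq]
    exact Nat.sSup_eq_iff_of_lowerSet
      (S := {m | lambertInstant G ε q.1.2 q.1.1 m ≤ ENNReal.ofReal q.2}) (by simp)
      (fun m n hmn hn => (monotone_lambertInstant q.1.2 q.1.1 hmn).trans hn) k
  rw [hset]
  refine measurableSet_setOf.2 ((((measurableSet_setOf.1 (hA k)).and
    (measurableSet_setOf.1 (hA (k + 1))).not)).or (measurable_const.and
      (Measurable.forall fun m => measurableSet_setOf.1 (hA m))))

/-- **The Lambertian flow is jointly measurable in `((z, ξs), t)`** (regular measurable geometry):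
`Λ_t(z; ξs) = S_{t − t_K} z_K` with `K = K_t(z; ξs)`, a measurable function of `(K, (z, ξs), t)` (countable
first factor) composed with the jointly measurable count. [folklore] -/
theorem measurable_lambertFlow_uncurry (hG : G.IsHardSphereRegular ε) (hGm : G.IsMeasurable) :
    Measurable fun q : (Config N d X × (ℕ → EuclideanSpace ℝ d)) × ℝ => lambertFlow G ε q.1.2 q.1.1 q.2 := by
  have hF : Measurable fun q : ℕ × ((Config N d X × (ℕ → EuclideanSpace ℝ d)) × ℝ) =>
      freeFlight G (q.2.2 - (lambertInstant G ε q.2.1.2 q.2.1.1 q.1).toReal)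
        (lambertStateAfter G ε q.2.1.2 q.2.1.1 q.1) :=
    measurable_from_prod_countable_right fun k => hGm.measurable_freeFlight₂.comp
      ((measurable_snd.sub ((measurable_lambertInstant hG hGm k).comp measurable_fst).ennreal_toReal).prodMk
        ((measurable_lambertStateAfter hG hGm k).comp measurable_fst))
  have h : (fun q : (Config N d X × (ℕ → EuclideanSpace ℝ d)) × ℝ => lambertFlow G ε q.1.2 q.1.1 q.2) =
      (fun q : ℕ × ((Config N d X × (ℕ → EuclideanSpace ℝ d)) × ℝ) =>
        freeFlight G (q.2.2 - (lambertInstant G ε q.2.1.2 q.2.1.1 q.1).toReal)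
          (lambertStateAfter G ε q.2.1.2 q.2.1.1 q.1)) ∘
        fun q => (lambertCount G ε q.1.2 q.1.1 q.2, q) :=
    funext fun q => rfl
  rw [h]
  exact hF.comp ((measurable_lambertCount_uncurry hG hGm).prodMk measurable_id)

end General

/-- **Joint space–time measurability of the Lambertian flow on `𝕋³`** at reduced diameter `hsDiameter σ N`,
`0 ≤ σ < 1/2`: `((z, ξs), t) ↦ Λ_t(z; ξs)` is measurable. [folklore] -/
theorem measurable_lambertFlow_uncurry_torus : ∀ {σ : ℝ}, 0 ≤ σ → σ < 2⁻¹ → ∀ N : ℕ,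
    Measurable fun q : (Config (N + 1) (Fin 3) T3 × (ℕ → V3)) × ℝ =>
      lambertFlow (Torus.geometry (Fin 3)) (hsDiameter σ N) q.1.2 q.1.1 q.2 := by
  intro σ hσ hσ' N
  exact measurable_lambertFlow_uncurry
    (Torus.isHardSphereRegular_geometry ((hsDiameter_le hσ N).trans_lt hσ')) Torus.isMeasurable_geometry

end Summit.AtomisticToContinuum.HydrodynamicLimit.Theorems.LambertianContactSwapLambertianEulerJointMeasurable

end
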